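import Literature.NumberTheory.Transcendental.RoySmallValueOrbitsK
import Mathlib.Algebra.Order.BigOperators.Ring.Finset
import HarnessLib

/-!
# Roy's small value estimate for `𝔾ₐ × 𝔾ₘ` — applying a test-family inequality to all conjugate families

Topic `Literature/NumberTheory/Transcendental`. Part of the formalisation of the proof of Roy 2013,
Theorem 1.1 (named fact `roy2013_thm_1_1`, `RoySmallValueEstimates.lean`), seat B. Source: D. Roy,
*A small value estimate for `𝔾ₐ × 𝔾ₘ`*, Mathematika 59 (2013) 333–363 = arXiv:1301.0663, §2,
Propositions 2.3–2.4 (p. 7) and §6, Prop. 6.2 (p. 16):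

> `log|a| + ∑_{α∈Z} log sup{|P(α)| ; P ∈ 𝒞} − 2 log(m+1) D deg(Z) ≤ h_𝒞(Z)` [...]
> `∑_{α∈Z} log sup{|P(α)| ; P ∈ 𝒞} ≤ h_𝒞(Z) − D h(Z) + 9 log(m+1) D deg(Z)`.

In the printed proof the height `h(Z)` of the `ℚ`-cycle enters `h_𝒞` through ALL conjugates of
its points at once. In this development the corresponding device is elementary: an inequality
`|c| ∏_j |R_j(α_j)|^{e_j} ≤ S` valid for EVERY admissible family of tests `(R_j)` (the tree's
`step2_core` + `prop_6_1`) can be applied to the re-indexed families `(R_{g⁻¹·j})_j` for all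
`g ∈ Aut(K/ℚ)` (`K` the number field of the configuration, `g` permuting the points via `perm g`
with the multiplicities `e_j` constant on orbits), and the product of the resulting `#Aut(K/ℚ)`
inequalities is

  `∏_j ( ∏_g |R_j(α_{g·j})| )^{e_j} ≤ (S/|c|)^{#Aut}`      (`prod_prod_conj_pow_le`),

in which every point now appears together with all its conjugates — ready for the product formula
(heights, `RoySmallValueGain`) and for Liouville's inequality on orbits
(`RoySmallValueOrbitLiouville`). We prove the abstract finite-product statement
(`prod_pow_prod_perm_le`, for any finite family of permutations) and its `ZeroConfigK` form.
Everything is proved; no definitions, no named facts.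

## References

* [Roy2013] D. Roy, *A small value estimate for 𝔾ₐ × 𝔾ₘ*, Mathematika 59 (2013), 333–363
  (arXiv:1301.0663), Propositions 2.3, 2.4 and 6.2 (the role of the conjugates / of `h(Z)`).
-/

noncomputable section

open Finset

namespace Literature.NumberTheory.Transcendental

namespace Roy2013

/-! ### The abstract statement -/

/-- **Products over a family of permutations.** Let `σ_g` (`g ∈ G`, finite) be permutations of the
finite index set, `e` exponents invariant under all `σ_g`, `v j i ≥ 0` ("size of test `j` at point
`i`"). If for every `g` the re-indexed family satisfies `∏_j v_{σ_g⁻¹ j}(j)^{e_j} ≤ S`, then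
`∏_j (∏_g v_j(σ_g j))^{e_j} ≤ S^{#G}`. [cite: Roy2013, Prop. 2.3–2.4 (all conjugates at once)] -/
theorem prod_pow_prod_perm_le {ι G : Type*} [Fintype ι] [Fintype G] (σ : G → Equiv.Perm ι)
    (e : ι → ℕ) (he : ∀ g j, e (σ g j) = e j) (v : ι → ι → ℝ) (hv : ∀ j i, 0 ≤ v j i) {S : ℝ}
    (H : ∀ g, ∏ j, v ((σ g).symm j) j ^ e j ≤ S) :
    ∏ j, (∏ g, v j (σ g j)) ^ e j ≤ S ^ Fintype.card G := by
  -- re-index each inequality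
  have H' : ∀ g, ∏ j, v j (σ g j) ^ e j ≤ S := by
    intro g
    have hre : ∏ j, v ((σ g).symm j) j ^ e j = ∏ j, v j (σ g j) ^ e j := by
      rw [← Equiv.prod_comp (σ g) (fun j => v ((σ g).symm j) j ^ e j)]
      refine Finset.prod_congr rfl fun j _ => ?_
      rw [Equiv.symm_apply_apply, he g j]
    rw [← hre]; exact H g
  -- multiply them
  calc ∏ j, (∏ g, v j (σ g j)) ^ e j = ∏ j, ∏ g, v j (σ g j) ^ e j := by
        refine Finset.prod_congr rfl fun j _ => ?_
        rw [Finset.prod_pow]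
    _ = ∏ g, ∏ j, v j (σ g j) ^ e j := Finset.prod_comm
    _ ≤ ∏ _g : G, S := Finset.prod_le_prod (fun g _ => prod_nonneg fun j _ => pow_nonneg (hv _ _) _)
        (fun g _ => H' g)
    _ = S ^ Fintype.card G := by rw [prod_const, card_univ]

/-! ### For the configuration of zeros -/

namespace ZeroConfigK

variable {K : IntermediateField ℚ ℂ} {ι : Type*} [Fintype ι] (Z : ZeroConfigK K ι) [NumberField K]

/-- **All conjugate families at once.** If `|c| ∏_j f_j(α_j)^{e_j} ≤ S` for every admissible family
of (non-negative) tests `f_j = |R_j(·)|`, with `e` constant on the orbits of `Aut(K/ℚ)`, then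
`∏_j (∏_g f_j(α_{perm g j}))^{e_j} ≤ (S/|c|)^{#Aut(K/ℚ)}` for every admissible family.
[cite: Roy2013, Propositions 2.3–2.4; §6, Prop. 6.2] -/
theorem prod_prod_conj_pow_le {X : Type*} (ok : X → Prop) (f : X → (Fin 3 → ℂ) → ℝ)
    (hf : ∀ x β, 0 ≤ f x β) (e : ι → ℕ) (he : ∀ g j, e (Z.perm g j) = e j) {c S : ℝ} (hc : 0 < c)
    (H : ∀ t : ι → X, (∀ j, ok (t j)) → c * ∏ j, f (t j) (Z.α j) ^ e j ≤ S)
    (t : ι → X) (ht : ∀ j, ok (t j)) :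
    ∏ j, (∏ g : K ≃ₐ[ℚ] K, f (t j) (Z.α (Z.perm g j))) ^ e j ≤
      (S / c) ^ Fintype.card (K ≃ₐ[ℚ] K) := by
  refine prod_pow_prod_perm_le (fun g => Z.permEquiv g) e (fun g j => he g j)
    (fun j i => f (t j) (Z.α i)) (fun j i => hf _ _) fun g => ?_
  -- the re-indexed family `j ↦ t (perm g⁻¹ j)` is admissible
  have h := H (fun j => t ((Z.permEquiv g).symm j)) (fun j => ht _)
  rw [le_div_iff₀ hc, mul_comm]
  exact h

end ZeroConfigK

end Roy2013

end Literature.NumberTheory.Transcendental
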